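import Summits.BirchSwinnertonDyer.Rank1Residual.X2.GreenbergVatsalStrictAtP
import Literature.NumberTheory.EllipticCurves.Greenberg1999.KummerImageGoodOrdinary
import Literature.NumberTheory.EllipticCurves.GreenbergVatsal2000.LocalConditionAtP
import HarnessLib

/-!
# A111 ⇐ A239: Greenberg–Vatsal's `L_𝔭 ⊆ im κ_𝔭` over `ℚ_∞` (the cell's fact
# `GreenbergVatsal2000.imKummer_ge_greenbergCondition_at_p`, registry A111) is a CONSEQUENCE of
# Greenberg 1999 Prop. 2.4 in its strict form (`Greenberg1999.imKummer_ge_strictCondition_goodOrdinary`,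
# registry A239) and the tree theorem "inertia form = strict form at the prime of `ℚ_∞` above a good
# ordinary `p`" (`X2/GreenbergVatsalStrictAtP.greenbergKer_le_strictKer`) — the composition the
# referee asked for (R141.3 registry note, R142: "A111 DERIVED still open")
# (cell `b2b-bsdres`, lane CLASS-CLOSURE, seat cc-typer-2; A239 is this seat's record)

HONEST FRAMING (cell `b2b-bsdres`, run/shared/lean/b2b/bsd-rank1-residual/, verbatim in every file):
the goal of the cell is to DELETE the COMBINATION-SHAPED residual classes of the Birch–Swinnerton-Dyer
formula for ALL analytic-rank `≤ 1` elliptic curves over `ℚ` — "full BSD formula for every rank `≤ 1`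
curve in class `C`" assembled STRICTLY from published theorems — so that the rank-`≤ 1` remainder
becomes exactly the CONSTRUCTION-SHAPED classes, which are TYPED (missing-input `Prop`s), NOT
attempted. This is not "finishing BSD". THEOREMS ONLY: no definition, no named fact (D-0026); nothing
is booked by this file; no RESIDUAL-MAP mark moves. EFFECT ON THE LEDGER OF FACTS: none is
discharged (`A239` stays a cited, unproved PUB record); what this file proves is the IMPLICATION
`A239 → A111`, so that the two records count as ONE independent hypothesis (A111 = DERIVED modulo
A239, as announced in A239's module docstring: "A111 is this statement at `H = ker κ` composed with
that theorem").

## The argument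

Both facts quantify over the same data: `E/ℚ` globally minimal, `p` good ordinary (`p ∤ Δ_E`,
`p ∤ a_p`), the cyclotomic `κ`, the place `v ∋ p`, a valuation `w` on `ℚ̄_v` computing the spectral
norm, the reduction map `red₀` of the minimal model over `𝒪_w`, and ANY Greenberg datum `N` at `v`
with `m ∈ N.plus ↔ red₀ (ι m) = 0`. A239 concludes `N.strictKer H ≤ W.localKerOver p H ℚ_v` for every
closed finite-index `H ≤ ker κ`, in particular for `H = ker κ` (its API
`imKummer_ge_strictCondition_goodOrdinary.kerSubgroup`); A111 concludes
`N.greenbergKer (ker κ) ≤ W.localKerOver p (ker κ) ℚ_v`. The missing step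
`N.greenbergKer (ker κ) ≤ N.strictKer (ker κ)` is the X2 lineage's theorem
`GreenbergVatsalStrictAtP.greenbergKer_le_strictKer`, stated for the tree's CHOSEN datum
`reductionDatum W p hpv hΔ` (`w = specVal v`, `red₀ = localRed`). §1 shows that the fact's
apparently more general data are that datum: the spectral-norm valuation on `ℚ̄_v` is unique
(`valuation_eq_specVal`: two `ℝ≥0`-valued valuations whose real values are the spectral norm are
equal), hence after substitution `red₀ = localRed W p hpv hΔ` pointwise (`hred₀` versus
`localRed_apply`, both the `reducePoint` of the transported point) and `N = reductionDatum W p hpv hΔ`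
(a `LocalDatum` is determined by its `plus` — the tree's `LocalDatum.eq_of_plus_eq`, inlined; membership
by `hN` versus `mem_reductionDatum_plus_iff`). §2 composes.

References: [GreenbergLNM1716] §2 Props. 2.2, 2.4 (pp. 73–75); [GreenbergVatsal2000] §2 pp. 16, 26;
[NeukirchANT1999] II (4.8) (uniqueness of the extended absolute value on an algebraic extension of a
complete field — here only the trivial consequence "two valuations with the same real values are
equal" is used); HOME/REFEREE.md R141.3 / R142; HOME/CITED-FACTS.md A111, A239.
-/

set_option autoImplicit false

noncomputable section

open scoped Classical NNReal

universe u

namespace Summit.BirchSwinnertonDyer.Rank1Residual.GaloisImage.GreenbergConditionOfStrictCondition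

open NumberField IsDedekindDomain Field Literature.NumberTheory.GaloisRepresentations
  Literature.NumberTheory.EllipticCurves Literature.NumberTheory.EllipticCurves.GreenbergSelmer
  Literature.NumberTheory.EllipticCurves.Greenberg1999
  Literature.NumberTheory.EllipticCurves.GreenbergVatsal2000
  Summit.BirchSwinnertonDyer.Rank1Residual.X2.GreenbergVatsalReductionDatum
  Summit.BirchSwinnertonDyer.Rank1Residual.X2.GreenbergVatsalStrictAtP
open WeierstrassCurve (minimalDiscriminantInt integralModelInt)

/-! ## §1. The fact's data ARE the tree's chosen datum -/

section Datum

/-- **Uniqueness of the spectral valuation**: an `ℝ≥0`-valued valuation on `K̄_v` whose real values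
are the spectral norm IS the tree's chosen `specVal v` (both compute `spectralNorm`; `ℝ≥0 → ℝ` is
injective). [cite: NeukirchANT1999, Ch. II Thm. (4.8)] -/
theorem valuation_eq_specVal {K : Type u} [Field K] [NumberField K] (v : HeightOneSpectrum (𝓞 K))
    (w : Valuation (AlgebraicClosure (v.adicCompletion K)) ℝ≥0)
    (hw : ∀ x, (w x : ℝ) =
      spectralNorm (v.adicCompletion K) (AlgebraicClosure (v.adicCompletion K)) x) :
    w = specVal v :=
  Valuation.ext fun x ↦ NNReal.coe_injective ((hw x).trans (specVal_spec v x).symm)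

variable (W : WeierstrassCurve ℚ) [W.IsGloballyMinimal] [W.IsElliptic] (p : ℕ) [hp : Fact p.Prime]
  {v : HeightOneSpectrum (𝓞 ℚ)}

omit [W.IsElliptic] in
/-- **Any reduction map of the fact's shape over `𝒪_{specVal v}` is the tree's `localRed`** (both are
the `reducePoint` of the point transported to the minimal integral model; `localRed_apply`).
[cite: SilvermanAEC2009, Prop. VII.2.1] -/
theorem eq_localRed (hpv : ((p : ℕ) : 𝓞 ℚ) ∈ v.asIdeal) (hΔ : ¬ (p : ℤ) ∣ minimalDiscriminantInt W)
    (red₀ : localPoints W (v.adicCompletion ℚ) →+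
      (((integralModelInt W).map (algebraMap ℤ ↥(specVal v).valuationSubring)).map
        (IsLocalRing.residue ↥(specVal v).valuationSubring)).toAffine.Point)
    (hred₀ : ∀ P : localPoints W (v.adicCompletion ℚ), red₀ P =
      ((integralModelInt W).map (algebraMap ℤ ↥(specVal v).valuationSubring)).reducePoint
        (WeierstrassCurve.Affine.Point.congrEquiv
          (W.localIntModel_baseChange (specVal v).valuationSubring).symm P)) :
    red₀ = localRed W p hpv hΔ :=
  AddMonoidHom.ext fun P ↦ (hred₀ P).trans (localRed_apply W p hpv hΔ P).symm

omit [W.IsElliptic] in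
/-- **Any Greenberg datum of the fact's shape is the tree's `reductionDatum`**: if
`m ∈ N.plus ↔ red_v (ι m) = 0` then `N = reductionDatum W p hpv hΔ`
(`mem_reductionDatum_plus_iff`; a `LocalDatum` is determined by its `plus`). [cite: GreenbergLNM1716, §2 p. 70] -/
theorem eq_reductionDatum (hpv : ((p : ℕ) : 𝓞 ℚ) ∈ v.asIdeal)
    (hΔ : ¬ (p : ℤ) ∣ minimalDiscriminantInt W) (N : LocalDatum ℚ (W.geomPrimaryTorsion p) v)
    (hN : ∀ m : W.geomPrimaryTorsion p,
      m ∈ N.plus ↔ localRed W p hpv hΔ (pointsMap W (v.adicCompletion ℚ) (m : W.geomPoints)) = 0) :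
    N = reductionDatum W p hpv hΔ := by
  -- a `LocalDatum` is determined by its `plus` (tree: `LocalDatum.eq_of_plus_eq`,
  -- `Additive/RamifiedLineKummerEqBridge`; inlined here to keep this file's imports local)
  obtain ⟨plus, hplus⟩ := N
  have h : plus = (reductionDatum W p hpv hΔ).plus :=
    AddSubgroup.ext fun m ↦ (hN m).trans (mem_reductionDatum_plus_iff W p hpv hΔ m).symm
  subst h
  rfl

end Datum

/-! ## §2. The composition: A239 ⟹ A111 -/

section Composition

/-- **A111 ⇐ A239.** Greenberg 1999 Prop. 2.4 in the strict form at every finite layer above `ℚ_∞`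
(`Greenberg1999.imKummer_ge_strictCondition_goodOrdinary`, A239) IMPLIES Greenberg–Vatsal's
`L_𝔭 ⊆ im κ_𝔭` over `ℚ_∞` in the inertia form
(`GreenbergVatsal2000.imKummer_ge_greenbergCondition_at_p`, A111): at the layer `H = ker κ` the fact
gives `strictKer ≤ localKerOver` (`.kerSubgroup`), and `greenbergKer ≤ strictKer` there is the X2
lineage's kernel theorem `GreenbergVatsalStrictAtP.greenbergKer_le_strictKer` (the cyclotomic tower is
totally ramified at `p`, so inertia fills the decomposition group up to a Frobenius, and `Frob − 1` is
onto on `Ẽ[p^∞]`), transported from the tree's chosen datum to the fact's data by §1. Hence the two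
registry records are ONE independent hypothesis (A111 DERIVED modulo A239); nothing is discharged.
[cite: GreenbergLNM1716, §2 Props. 2.2, 2.4 and the remark following (pp. 73–75)]
[cite: GreenbergVatsal2000, §2 p. 16 (L_𝔭) and p. 26 ("In [Gre99] … im(κ_𝔭) = L_𝔭")] -/
theorem imKummer_ge_greenbergCondition_at_p_of_strict
    (h : imKummer_ge_strictCondition_goodOrdinary) : imKummer_ge_greenbergCondition_at_p := by
  intro W _ _ p _ hΔ hord κ hκ v hpv w hw red₀ hred₀ N hN
  obtain rfl : w = specVal v := valuation_eq_specVal v w hw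
  have hred : red₀ = localRed W p hpv hΔ := eq_localRed W p hpv hΔ red₀ hred₀
  subst hred
  obtain rfl : N = reductionDatum W p hpv hΔ := eq_reductionDatum W p hpv hΔ N hN
  exact (greenbergKer_le_strictKer W p κ hκ hpv hΔ hord).trans
    (imKummer_ge_strictCondition_goodOrdinary.kerSubgroup W p hΔ hord κ hκ v hpv (specVal v)
      (specVal_spec v) (localRed W p hpv hΔ) (localRed_apply W p hpv hΔ) (reductionDatum W p hpv hΔ)
      (mem_reductionDatum_plus_iff W p hpv hΔ) h)

/-- The same at the tree's chosen datum, as an inequality ready for consumers that hold A239 but are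
written against A111's conclusion (`reductionDatum`, `H = ker κ`): `greenbergKer ≤ localKerOver`.
[cite: GreenbergLNM1716, §2 Prop. 2.4 (pp. 74–75)] [cite: GreenbergVatsal2000, §2 p. 26] -/
theorem greenbergKer_reductionDatum_le_localKerOver_of_strict
    (h : imKummer_ge_strictCondition_goodOrdinary) (W : WeierstrassCurve ℚ) [W.IsGloballyMinimal]
    [W.IsElliptic] (p : ℕ) [Fact p.Prime] (hΔ : ¬ (p : ℤ) ∣ minimalDiscriminantInt W)
    (hord : ¬ (p : ℤ) ∣ W.frobeniusTrace p) (κ : ZpExtension ℚ p) (hκ : κ.IsCyclotomic)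
    {v : HeightOneSpectrum (𝓞 ℚ)} (hpv : ((p : ℕ) : 𝓞 ℚ) ∈ v.asIdeal) :
    (reductionDatum W p hpv hΔ).greenbergKer κ.kerSubgroup ≤
      W.localKerOver p κ.kerSubgroup (v.adicCompletion ℚ) :=
  imKummer_ge_greenbergCondition_at_p_of_strict h W p hΔ hord κ hκ v hpv (specVal v) (specVal_spec v)
    (localRed W p hpv hΔ) (localRed_apply W p hpv hΔ) (reductionDatum W p hpv hΔ)
    (mem_reductionDatum_plus_iff W p hpv hΔ)

/-- **All three local conditions at `p` coincide over `ℚ_∞^{cyc}` modulo A239 ALONE** (X2's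
`localKerOver_eq_greenbergKer_and_strictKer` fed with the derived A111): Kummer = inertia form =
strict form for the good-ordinary reduction datum. [cite: GreenbergLNM1716, §2 Props. 2.2, 2.4 (pp. 73–75)]
[cite: GreenbergVatsal2000, §2 p. 26] -/
theorem localKerOver_eq_greenbergKer_and_strictKer_of_strict
    (h : imKummer_ge_strictCondition_goodOrdinary) (W : WeierstrassCurve ℚ) [W.IsGloballyMinimal]
    [W.IsElliptic] (p : ℕ) [Fact p.Prime] (κ : ZpExtension ℚ p) (hκ : κ.IsCyclotomic)
    {v : HeightOneSpectrum (𝓞 ℚ)} (hpv : ((p : ℕ) : 𝓞 ℚ) ∈ v.asIdeal)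
    (hΔ : ¬ (p : ℤ) ∣ minimalDiscriminantInt W) (hord : ¬ (p : ℤ) ∣ W.frobeniusTrace p) :
    W.localKerOver p κ.kerSubgroup (v.adicCompletion ℚ) =
        (reductionDatum W p hpv hΔ).greenbergKer κ.kerSubgroup ∧
      W.localKerOver p κ.kerSubgroup (v.adicCompletion ℚ) =
        (reductionDatum W p hpv hΔ).strictKer κ.kerSubgroup :=
  localKerOver_eq_greenbergKer_and_strictKer W p κ (imKummer_ge_greenbergCondition_at_p_of_strict h)
    hκ hpv hΔ hord

end Composition

end Summit.BirchSwinnertonDyer.Rank1Residual.GaloisImage.GreenbergConditionOfStrictCondition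

end
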